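import Summits.AtomisticToContinuum.BoseEinsteinCondensation.Theorems.BECInsertionCorrectorStaticResponseBoundModulationEulerLagrange
import Literature.MathematicalPhysics.QuantumManyBody.CouplingPathSliceFloor

/-!
# Route `BECInsertionCorrector`, support item `StaticResponseToHMinusOne`
# (stmt-AtomisticToContinuum-12060) — II: the energy of `θ|Θ|` in real form

For a measurable weight `W : (ℝ³)^N → [0,∞]` computing the periodic energy
(`⟨Ψ,HΨ⟩ = ∫⁻_cell |∇Ψ|² + W|Ψ|²`, part I) and a real nonnegative periodic trial state `Θ` of
finite energy (zeros allowed: where `W = ∞` the state vanishes a.e.), every state `Ψ = θ|Θ|`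
(`θ` real `C¹`) has energy `∫|∇(θ|Θ|)|² + ∫ W.toReal (θ|Θ|)²` as real Bochner integrals
(`energy_eq_ofReal_of_eq_mul`); second-order expansions along `(1 + εζ)|Θ|`; the normalised
perturbed states `c_ε (1 + εζ)|Θ|` are admissible for small `ε` (`exists_perturbedState`,
`energy_perturbedState`). Adapted from the sibling crux's `…ModulationRealForm` (which needs
`Θ > 0` pointwise and a measurable profile). References: [ReedSimonIV1978] §XIII.1; [Davies1989] §4.2.
-/

noncomputable section

open MeasureTheory Filter Set Metric
open scoped ENNReal NNReal Topology BigOperators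

namespace Summit.AtomisticToContinuum.BoseEinsteinCondensation.Theorems.StaticResponseToHMinusOne

open Literature.MathematicalPhysics.QuantumManyBody.BoseGas
open Summit.AtomisticToContinuum.BoseEinsteinCondensation.Cruxes.StaticResponseBound.UvThomsonForceWave
  (norm_eq_re_of_real contDiff_norm_of_real kineticDensity_ofReal_eq_gradDot exists_bound_on_cellN)
open Summit.AtomisticToContinuum.BoseEinsteinCondensation.Theorems.StaticResponseBound.Negative
  (integral_norm_sq_eq_one)

variable {N : ℕ} {L : ℝ}

/-! ### Elementary tools -/

/-- The squared modulus of a state `θ|Θ|` in real form. [folklore] -/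
theorem norm_sq_of_eq_mul (Θ : PeriodicTrialState N L) {ψ : Config N → ℂ} {θ : Config N → ℝ}
    (hψ : ∀ X, ψ X = ((θ X * ‖Θ.ψ X‖ : ℝ) : ℂ)) (X : Config N) :
    ‖ψ X‖ ^ 2 = (θ X * ‖Θ.ψ X‖) ^ 2 := by
  rw [hψ X, Complex.norm_real, Real.norm_eq_abs, sq_abs]

/-! ### Finite energy: the weight is a.e. finite against `|Θ|²` -/

section FiniteEnergy

variable {W : Config N → ℝ≥0∞} {Θ : PeriodicTrialState N L}

/-- If `∫⁻_cell |∇Θ|² + W|Θ|² < ∞` then `W|Θ|² < ∞` a.e. on the cell. [folklore] -/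
theorem ae_weight_mul_lt_top (hW : Measurable W)
    (hfin : (∫⁻ X in cellN N L, kineticDensity Θ.ψ X + W X * ((‖Θ.ψ X‖₊ : ℝ≥0∞)) ^ 2) ≠ ⊤) :
    ∀ᵐ X ∂(volume.restrict (cellN N L)), W X * ((‖Θ.ψ X‖₊ : ℝ≥0∞)) ^ 2 < ⊤ := by
  have hmeas : Measurable fun X => W X * ((‖Θ.ψ X‖₊ : ℝ≥0∞)) ^ 2 :=
    hW.mul ((Θ.contDiff.continuous.measurable.nnnorm.coe_nnreal_ennreal).pow_const _)
  have hle : (∫⁻ X in cellN N L, W X * ((‖Θ.ψ X‖₊ : ℝ≥0∞)) ^ 2) ≠ ⊤ :=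
    ne_top_of_le_ne_top hfin (lintegral_mono fun X => le_add_self)
  exact ae_lt_top hmeas hle

/-- For a finite-energy state, the real density `W.toReal |Θ|²` is integrable on the cell. [folklore] -/
theorem integrableOn_toReal_weight_mul_norm_sq (hW : Measurable W)
    (hfin : (∫⁻ X in cellN N L, kineticDensity Θ.ψ X + W X * ((‖Θ.ψ X‖₊ : ℝ≥0∞)) ^ 2) ≠ ⊤) :
    IntegrableOn (fun X => (W X).toReal * ‖Θ.ψ X‖ ^ 2) (cellN N L) := by
  have hmeasU : Measurable fun X => (W X).toReal * ‖Θ.ψ X‖ ^ 2 :=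
    hW.ennreal_toReal.mul ((Θ.contDiff.continuous.norm.measurable).pow_const _)
  have hnn : ∀ X, 0 ≤ (W X).toReal * ‖Θ.ψ X‖ ^ 2 := fun X =>
    mul_nonneg ENNReal.toReal_nonneg (sq_nonneg _)
  refine ⟨hmeasU.aestronglyMeasurable, ?_⟩
  rw [hasFiniteIntegral_iff_ofReal (ae_of_all _ hnn)]
  have hle : (∫⁻ X in cellN N L, W X * ((‖Θ.ψ X‖₊ : ℝ≥0∞)) ^ 2) ≠ ⊤ :=
    ne_top_of_le_ne_top hfin (lintegral_mono fun X => le_add_self)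
  refine lt_of_le_of_lt (lintegral_mono fun X => ?_) (lt_top_iff_ne_top.2 hle)
  rw [ENNReal.ofReal_mul ENNReal.toReal_nonneg, coe_nnnorm_sq_eq_ofReal]
  exact mul_le_mul' ENNReal.ofReal_toReal_le le_rfl

/-- Pointwise a.e. identity behind the real form: `W · ofReal((θ|Θ|)²) = ofReal(W.toReal (θ|Θ|)²)`
a.e. on the cell (where `W = ∞` the state vanishes). [folklore] -/
theorem ae_weight_mul_ofReal_eq (hW : Measurable W)
    (hfin : (∫⁻ X in cellN N L, kineticDensity Θ.ψ X + W X * ((‖Θ.ψ X‖₊ : ℝ≥0∞)) ^ 2) ≠ ⊤)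
    (θ : Config N → ℝ) :
    ∀ᵐ X ∂(volume.restrict (cellN N L)),
      W X * ENNReal.ofReal ((θ X * ‖Θ.ψ X‖) ^ 2) = ENNReal.ofReal ((W X).toReal * (θ X * ‖Θ.ψ X‖) ^ 2) := by
  filter_upwards [ae_weight_mul_lt_top hW hfin] with X hX
  rcases eq_or_ne (W X) ⊤ with htop | htop
  · -- the state vanishes here
    have h0 : ((‖Θ.ψ X‖₊ : ℝ≥0∞)) ^ 2 = 0 := by
      by_contra h0
      rw [htop, ENNReal.top_mul h0] at hX
      exact lt_irrefl _ hX
    have h0' : ‖Θ.ψ X‖ = 0 := by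
      rw [coe_nnnorm_sq_eq_ofReal, ENNReal.ofReal_eq_zero] at h0
      nlinarith [norm_nonneg (Θ.ψ X), h0]
    simp [htop, h0']
  · rw [ENNReal.ofReal_mul ENNReal.toReal_nonneg, ENNReal.ofReal_toReal htop]

end FiniteEnergy

/-! ### The energy of `θ|Θ|` in real form -/

section RealForm

variable {v : ℝ → ℝ≥0∞} {W : Config N → ℝ≥0∞} {Θ : PeriodicTrialState N L}

/-- **Real form of the energy.** Let `W` be a measurable weight computing the periodic energy,
`Θ` a real nonnegative periodic state of finite energy and `Ψ` a periodic state with `Ψ = θ|Θ|`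
for a real `C¹` function `θ`. Then `⟨Ψ,HΨ⟩ = ∫_cell |∇(θ|Θ|)|² + ∫_cell W.toReal (θ|Θ|)²` (real Bochner
integrals). [folklore] -/
theorem energy_eq_ofReal_of_eq_mul (hW : Measurable W)
    (hEW : ∀ Ψ : PeriodicTrialState N L, periodicEnergy v Ψ =
      ∫⁻ X in cellN N L, kineticDensity Ψ.ψ X + W X * ((‖Ψ.ψ X‖₊ : ℝ≥0∞)) ^ 2)
    (hreal : ∀ X, Θ.ψ X = (‖Θ.ψ X‖ : ℂ)) (hfin : periodicEnergy v Θ ≠ ⊤)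
    (Ψ : PeriodicTrialState N L) {θ : Config N → ℝ} (hθ : ContDiff ℝ 1 θ)
    (hΨ : ∀ X, Ψ.ψ X = ((θ X * ‖Θ.ψ X‖ : ℝ) : ℂ)) :
    periodicEnergy v Ψ = ENNReal.ofReal
      ((∫ X in cellN N L, gradDot (fun Y => θ Y * ‖Θ.ψ Y‖) (fun Y => θ Y * ‖Θ.ψ Y‖) X) +
        ∫ X in cellN N L, (W X).toReal * (θ X * ‖Θ.ψ X‖) ^ 2) := by
  have hfin' : (∫⁻ X in cellN N L, kineticDensity Θ.ψ X + W X * ((‖Θ.ψ X‖₊ : ℝ≥0∞)) ^ 2) ≠ ⊤ := by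
    rw [← hEW Θ]; exact hfin
  set G : Config N → ℝ := fun X => θ X * ‖Θ.ψ X‖ with hGdef
  have hG : ContDiff ℝ 1 G := hθ.mul (contDiff_norm_of_real Θ hreal)
  have hΨfun : Ψ.ψ = fun X => ((G X : ℝ) : ℂ) := funext hΨ
  -- pointwise integrand
  have hpt : ∀ X, kineticDensity Ψ.ψ X + W X * ((‖Ψ.ψ X‖₊ : ℝ≥0∞)) ^ 2 =
      ENNReal.ofReal (gradDot G G X) + W X * ENNReal.ofReal (G X ^ 2) := by
    intro X
    rw [hΨfun, kineticDensity_ofReal_eq_gradDot (hG.differentiable one_ne_zero)]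
    dsimp only
    rw [coe_nnnorm_sq_eq_ofReal, Complex.norm_real, Real.norm_eq_abs, sq_abs]
  -- `θ` is bounded on the cell
  obtain ⟨M, -, hM⟩ := exists_bound_on_cellN hθ.continuous L
  -- integrability of the two real densities
  have hint1 : IntegrableOn (fun X => gradDot G G X) (cellN N L) :=
    integrableOn_cellN (continuous_gradDot hG hG) L
  have hint2 : IntegrableOn (fun X => (W X).toReal * G X ^ 2) (cellN N L) := by
    have h0 := integrableOn_toReal_weight_mul_norm_sq (Θ := Θ) hW hfin'
    have hfun : (fun X => (W X).toReal * G X ^ 2) =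
        fun X => θ X ^ 2 * ((W X).toReal * ‖Θ.ψ X‖ ^ 2) := by
      funext X; simp only [hGdef]; ring
    rw [hfun]
    refine Integrable.bdd_mul h0 ((hθ.continuous.pow 2).aestronglyMeasurable) (c := M ^ 2) ?_
    rw [ae_restrict_iff' (measurableSet_cellN N L)]
    refine ae_of_all _ fun X hX => ?_
    rw [Real.norm_eq_abs, abs_pow]
    have h1 := hM X hX
    have h2 := abs_nonneg (θ X)
    nlinarith
  rw [hEW Ψ]
  simp_rw [hpt]
  rw [lintegral_add_left (continuous_gradDot hG hG).measurable.ennreal_ofReal]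
  have e1 : ∫⁻ X in cellN N L, ENNReal.ofReal (gradDot G G X) =
      ENNReal.ofReal (∫ X in cellN N L, gradDot G G X) :=
    (ofReal_integral_eq_lintegral_ofReal hint1 (ae_of_all _ fun X => gradDot_self_nonneg G X)).symm
  have e2 : ∫⁻ X in cellN N L, W X * ENNReal.ofReal (G X ^ 2) =
      ENNReal.ofReal (∫ X in cellN N L, (W X).toReal * G X ^ 2) := by
    rw [ofReal_integral_eq_lintegral_ofReal hint2
      (ae_of_all _ fun X => mul_nonneg ENNReal.toReal_nonneg (sq_nonneg _))]
    exact lintegral_congr_ae (ae_weight_mul_ofReal_eq hW hfin' θ)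
  rw [e1, e2, ← ENNReal.ofReal_add (integral_nonneg fun X => gradDot_self_nonneg G X)
    (integral_nonneg fun X => mul_nonneg ENNReal.toReal_nonneg (sq_nonneg _))]

/-- In the setting of `energy_eq_ofReal_of_eq_mul` the energy of `Ψ` is finite. [folklore] -/
theorem energy_ne_top_of_eq_mul (hW : Measurable W)
    (hEW : ∀ Ψ : PeriodicTrialState N L, periodicEnergy v Ψ =
      ∫⁻ X in cellN N L, kineticDensity Ψ.ψ X + W X * ((‖Ψ.ψ X‖₊ : ℝ≥0∞)) ^ 2)
    (hreal : ∀ X, Θ.ψ X = (‖Θ.ψ X‖ : ℂ)) (hfin : periodicEnergy v Θ ≠ ⊤)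
    (Ψ : PeriodicTrialState N L) {θ : Config N → ℝ} (hθ : ContDiff ℝ 1 θ)
    (hΨ : ∀ X, Ψ.ψ X = ((θ X * ‖Θ.ψ X‖ : ℝ) : ℂ)) :
    periodicEnergy v Ψ ≠ ⊤ := by
  rw [energy_eq_ofReal_of_eq_mul hW hEW hreal hfin Ψ hθ hΨ]
  exact ENNReal.ofReal_ne_top

/-- In the setting of `energy_eq_ofReal_of_eq_mul`, the real form of the energy. [folklore] -/
theorem toReal_energy_of_eq_mul (hW : Measurable W)
    (hEW : ∀ Ψ : PeriodicTrialState N L, periodicEnergy v Ψ =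
      ∫⁻ X in cellN N L, kineticDensity Ψ.ψ X + W X * ((‖Ψ.ψ X‖₊ : ℝ≥0∞)) ^ 2)
    (hreal : ∀ X, Θ.ψ X = (‖Θ.ψ X‖ : ℂ)) (hfin : periodicEnergy v Θ ≠ ⊤)
    (Ψ : PeriodicTrialState N L) {θ : Config N → ℝ} (hθ : ContDiff ℝ 1 θ)
    (hΨ : ∀ X, Ψ.ψ X = ((θ X * ‖Θ.ψ X‖ : ℝ) : ℂ)) :
    (periodicEnergy v Ψ).toReal =
      (∫ X in cellN N L, gradDot (fun Y => θ Y * ‖Θ.ψ Y‖) (fun Y => θ Y * ‖Θ.ψ Y‖) X) +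
        ∫ X in cellN N L, (W X).toReal * (θ X * ‖Θ.ψ X‖) ^ 2 := by
  rw [energy_eq_ofReal_of_eq_mul hW hEW hreal hfin Ψ hθ hΨ, ENNReal.toReal_ofReal]
  exact add_nonneg (integral_nonneg fun X => gradDot_self_nonneg _ X)
    (integral_nonneg fun X => mul_nonneg ENNReal.toReal_nonneg (sq_nonneg _))

end RealForm

/-! ### The normalised perturbed states `(1 + εζ)Θ/‖(1 + εζ)Θ‖` -/

section Perturbation

variable {v : ℝ → ℝ≥0∞} {W : Config N → ℝ≥0∞} {Θ : PeriodicTrialState N L}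

/-- **Admissible perturbations.** For a real nonnegative periodic state `Θ` and a real `C¹`
lattice-periodic Bose-symmetric `ζ`, for `|ε| < 1/(2(M+1))` (`M` a bound of `|ζ|` on the cell, so
that `1 + εζ ≥ 1/2` there and `∫_cell |(1+εζ)Θ|² ≥ 1/4`) the function `(1 + εζ)|Θ|` normalised on
the cell is an admissible periodic trial state `Ψ_ε = c_ε (1 + εζ)|Θ|`, `c_ε > 0`. [folklore] -/
theorem exists_perturbedState (hreal : ∀ X, Θ.ψ X = (‖Θ.ψ X‖ : ℂ))
    {ζ : Config N → ℝ} (hζ : ContDiff ℝ 1 ζ) (hζper : IsLatticePeriodic L ζ)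
    (hζsymm : ∀ (σ : Equiv.Perm (Fin N)) (X : Config N), ζ (X ∘ σ) = ζ X) :
    ∃ ε₀ : ℝ, 0 < ε₀ ∧ ∀ ε : ℝ, |ε| < ε₀ → ∃ Ψ : PeriodicTrialState N L, ∃ c : ℝ, 0 < c ∧
      ∀ X, Ψ.ψ X = ((c * (1 + ε * ζ X) * ‖Θ.ψ X‖ : ℝ) : ℂ) := by
  obtain ⟨M, hM0, hM⟩ := exists_bound_on_cellN hζ.continuous L
  refine ⟨1 / (2 * (M + 1)), by positivity, fun ε hε => ?_⟩
  set ψε : Config N → ℂ := fun X => (((1 + ε * ζ X) * ‖Θ.ψ X‖ : ℝ) : ℂ) with hψε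
  have hF : ContDiff ℝ 1 fun X => ‖Θ.ψ X‖ := contDiff_norm_of_real Θ hreal
  have hGc : ContDiff ℝ 1 fun X => (1 + ε * ζ X) * ‖Θ.ψ X‖ :=
    (contDiff_const.add (contDiff_const.mul hζ)).mul hF
  have hC : ContDiff ℝ 1 ψε := Complex.ofRealCLM.contDiff.comp hGc
  have hper : ∀ (X : Config N) (i : Fin N) (a : Fin 3),
      ψε (X + Pi.single i (EuclideanSpace.single a L)) = ψε X := by
    intro X i a; simp only [hψε, hζper X i a, Θ.periodic X i a]
  have hsymm : ∀ (σ : Equiv.Perm (Fin N)) (X : Config N), ψε (X ∘ σ) = ψε X := by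
    intro σ X; simp only [hψε, hζsymm σ X, Θ.symm σ X]
  -- on the cell `1 + εζ ≥ 1/2`
  have hhalf : ∀ X ∈ cellN N L, 1 / 2 ≤ 1 + ε * ζ X := by
    intro X hX
    have h1 : |ε * ζ X| ≤ 1 / 2 := by
      rw [abs_mul]
      have hz := hM X hX
      have hεM : |ε| * |ζ X| ≤ 1 / (2 * (M + 1)) * M :=
        mul_le_mul hε.le hz (abs_nonneg _) (by positivity)
      have h2 : 1 / (2 * (M + 1)) * M ≤ 1 / 2 := by
        rw [div_mul_eq_mul_div, one_mul, div_le_div_iff₀ (by positivity) (by positivity)]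
        nlinarith
      exact hεM.trans h2
    linarith [neg_abs_le (ε * ζ X)]
  -- hence `|ψε|² ≥ |Θ|²/4` on the cell and the mass is at least `1/4`
  have hptle : ∀ X ∈ cellN N L,
      ENNReal.ofReal (1 / 4) * ((‖Θ.ψ X‖₊ : ℝ≥0∞)) ^ 2 ≤ ((‖ψε X‖₊ : ℝ≥0∞)) ^ 2 := by
    intro X hX
    rw [coe_nnnorm_sq_eq_ofReal, coe_nnnorm_sq_eq_ofReal, ← ENNReal.ofReal_mul (by norm_num)]
    refine ENNReal.ofReal_le_ofReal ?_
    simp only [hψε, Complex.norm_real, Real.norm_eq_abs, sq_abs]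
    have h := hhalf X hX
    have hn := norm_nonneg (Θ.ψ X)
    nlinarith [sq_nonneg (‖Θ.ψ X‖), mul_self_nonneg (1 + ε * ζ X - 1 / 2)]
  have hmass : ENNReal.ofReal (1 / 4) ≤ ∫⁻ X in cellN N L, ((‖ψε X‖₊ : ℝ≥0∞)) ^ 2 := by
    calc ENNReal.ofReal (1 / 4) = ENNReal.ofReal (1 / 4) * ∫⁻ X in cellN N L, ((‖Θ.ψ X‖₊ : ℝ≥0∞)) ^ 2 := by
          rw [Θ.norm_eq, mul_one]
      _ = ∫⁻ X in cellN N L, ENNReal.ofReal (1 / 4) * ((‖Θ.ψ X‖₊ : ℝ≥0∞)) ^ 2 :=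
          (lintegral_const_mul' _ _ ENNReal.ofReal_ne_top).symm
      _ ≤ ∫⁻ X in cellN N L, ((‖ψε X‖₊ : ℝ≥0∞)) ^ 2 := by
          refine lintegral_mono_ae ?_
          rw [ae_restrict_iff' (measurableSet_cellN N L)]
          exact ae_of_all _ hptle
  have h0 : ∫⁻ X in cellN N L, ((‖ψε X‖₊ : ℝ≥0∞)) ^ 2 ≠ 0 := by
    intro h0
    rw [h0, nonpos_iff_eq_zero, ENNReal.ofReal_eq_zero] at hmass
    norm_num at hmass
  have htop : ∫⁻ X in cellN N L, ((‖ψε X‖₊ : ℝ≥0∞)) ^ 2 ≠ ⊤ :=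
    lintegral_cellN_normSq_ne_top hC.continuous L
  refine ⟨PeriodicTrialState.ofFun ψε hC hper hsymm h0 htop,
    (Real.sqrt (∫⁻ X in cellN N L, ((‖ψε X‖₊ : ℝ≥0∞)) ^ 2).toReal)⁻¹,
    inv_pos.2 (Real.sqrt_pos.2 (ENNReal.toReal_pos h0 htop)), fun X => ?_⟩
  rw [PeriodicTrialState.ofFun_apply]
  simp only [hψε]
  push_cast
  ring

/-- **Energy of a perturbed state.** For `Ψ = c(1 + εζ)|Θ|` admissible and `g` continuous:
`⟨Ψ,HΨ⟩ < ∞`, `⟨Ψ,HΨ⟩ = c² (∫|∇G_ε|² + ∫ W.toReal G_ε²)`, `∫ g|Ψ|² = c² ∫ g G_ε²` and `c² ∫ G_ε² = 1`,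
where `G_ε = (1 + εζ)|Θ|`. [folklore] -/
theorem energy_perturbedState (hW : Measurable W)
    (hEW : ∀ Ψ : PeriodicTrialState N L, periodicEnergy v Ψ =
      ∫⁻ X in cellN N L, kineticDensity Ψ.ψ X + W X * ((‖Ψ.ψ X‖₊ : ℝ≥0∞)) ^ 2)
    (hreal : ∀ X, Θ.ψ X = (‖Θ.ψ X‖ : ℂ)) (hfin : periodicEnergy v Θ ≠ ⊤) (ε : ℝ)
    {ζ : Config N → ℝ} (hζ : ContDiff ℝ 1 ζ) (g : Config N → ℝ) (Ψ : PeriodicTrialState N L)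
    {c : ℝ} (hΨ : ∀ X, Ψ.ψ X = ((c * (1 + ε * ζ X) * ‖Θ.ψ X‖ : ℝ) : ℂ)) :
    periodicEnergy v Ψ ≠ ⊤ ∧
    (periodicEnergy v Ψ).toReal = c ^ 2 *
      ((∫ X in cellN N L, gradDot (fun Y => (1 + ε * ζ Y) * ‖Θ.ψ Y‖)
          (fun Y => (1 + ε * ζ Y) * ‖Θ.ψ Y‖) X) +
        ∫ X in cellN N L, (W X).toReal * ((1 + ε * ζ X) * ‖Θ.ψ X‖) ^ 2) ∧
    (∫ X in cellN N L, g X * ‖Ψ.ψ X‖ ^ 2) =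
      c ^ 2 * ∫ X in cellN N L, g X * ((1 + ε * ζ X) * ‖Θ.ψ X‖) ^ 2 ∧
    c ^ 2 * ∫ X in cellN N L, ((1 + ε * ζ X) * ‖Θ.ψ X‖) ^ 2 = 1 := by
  set θ : Config N → ℝ := fun X => c * (1 + ε * ζ X) with hθdef
  have hθ : ContDiff ℝ 1 θ := contDiff_const.mul (contDiff_const.add (contDiff_const.mul hζ))
  have hΨ' : ∀ X, Ψ.ψ X = ((θ X * ‖Θ.ψ X‖ : ℝ) : ℂ) := fun X => by rw [hΨ X]
  have hfun : (fun Y => θ Y * ‖Θ.ψ Y‖) = c • fun Y => (1 + ε * ζ Y) * ‖Θ.ψ Y‖ := by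
    funext Y; simp only [hθdef, Pi.smul_apply, smul_eq_mul]; ring
  have hsq : ∀ X, (θ X * ‖Θ.ψ X‖) ^ 2 = c ^ 2 * ((1 + ε * ζ X) * ‖Θ.ψ X‖) ^ 2 := fun X => by
    simp only [hθdef]; ring
  refine ⟨energy_ne_top_of_eq_mul hW hEW hreal hfin Ψ hθ hΨ', ?_, ?_, ?_⟩
  · rw [toReal_energy_of_eq_mul hW hEW hreal hfin Ψ hθ hΨ', hfun]
    simp_rw [gradDot_smul_left, gradDot_smul_right, hsq]
    simp_rw [← mul_assoc, mul_comm _ (c ^ 2), mul_assoc, integral_const_mul]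
    ring
  · rw [← integral_const_mul]
    congr 1 with X
    rw [norm_sq_of_eq_mul Θ hΨ' X, hsq X]
    ring
  · rw [← integral_const_mul]
    simp_rw [← hsq]
    have h := integral_norm_sq_eq_one Ψ
    simp_rw [norm_sq_of_eq_mul Θ hΨ'] at h
    exact h

end Perturbation

end Summit.AtomisticToContinuum.BoseEinsteinCondensation.Theorems.StaticResponseToHMinusOne

end
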